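import Summits.CriticalPhenomena.PercolationContinuityZ3.Theorems.Transplant.CayleyMilnorTransitive
import HarnessLib

/-!
# The chart datum of a transitive action by automorphisms (NO finite stabilisers): the equivariant chart `ψ ∘ sec`, exact steps, boxed walks,
# kernel walks

builds on p205010 (kernel theorem, internal audit signed; external expert review pending) — nothing in this file uses p205010; nothing here is a claim about the OPEN node `SamePDropOfSkeletonFrmScaled₁`.
Lane `prim-bschramm`, seat `prim-bschramm-p4` gen 25 (PART C3 of `P4-GENERAL.md` §47: INPUT(G) WITHOUT FINITE STABILISERS).  Helper file
(`--supports stmt-CriticalPhenomena-4575 --as helper`).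

* **`AutChart.ChartDatum G A t`**: a transitive action of `A` by automorphisms of the connected graph `G`, an additive `ψ : A → ℤ²` KILLING
  `Stab(t)` (no finiteness), of sup-norm `≤ N` on the movers of `t` to its neighbours, two movers with `ψ = N eᵢ` EXACTLY, and a bound `m` such
  that `ker ψ` is generated by kernel elements moving `t` by at most `m` (supplied by the relative Milnor kernel lemma, file
  `AutRelMilnorKernelTwo`; the datum is CONSTRUCTED in `AutChartCriticalContinuity`);
* the chart `φ = ψ ∘ sec` of `G` (`sec` a section of the orbit map; well defined because `ψ` kills the stabiliser): `φ(a • w) = ψ a + φ w`,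
  `N`-Lipschitz along edges, exact `±N eᵢ` steps along single edges at EVERY vertex;
* boxed walks `InBox R u v` (a walk along which `φ` stays in `Λ_R`): translation by `a` costs `‖ψ a‖_∞`, a walk of length `ℓ` costs `Nℓ`, and
  **every kernel element moves `t` inside `Λ_{Nm}`** (`ker_inBox`, closure induction over the bounded kernel generators).
Sequel `AutChartCylinders`: (κ′) and the one-type `PlanarSkeletonFrmScaled`.
[cite: KozmaNitzan2024, §4 p. 16 (Lemma 8)] [cite: MartineauTassion2017, §3.2] [cite: BenjaminiSchramm1996, §2 (almost transitive graphs)]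
-/

noncomputable section

namespace Summit.CriticalPhenomena.PercolationContinuityZ3.Theorems.Transplant

open SimpleGraph Filter Literature.Barriers.CriticalPhenomena Literature.Probability.LatticeModels Literature.Probability.Percolation
open scoped Classical

namespace AutChart

variable {V : Type} {G : SimpleGraph V} {A : Type} [Group A] [MulAction A V] {t : V}

/-- **Chart datum at the base vertex `t`** for a group `A` acting transitively by automorphisms on a connected graph: an additive `ψ : A → ℤ²`
killing `Stab(t)`, of sup-norm `≤ N` on the movers of `t` to its neighbours, with two movers `gen i` realising the EXACT steps `N eᵢ`, and a
displacement bound `m` such that `ker ψ` is generated by kernel elements moving `t` by at most `m`.  (Produced by `exists_datum` from a rank-2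
character killing the stabiliser and subexponential growth; consumed by `skeleton`.) [cite: KozmaNitzan2024, §4 p. 16 (Lemma 8)]
[cite: MilnorSolvableGrowth1968, Lemma 1] -/
structure ChartDatum (G : SimpleGraph V) (A : Type) [Group A] [MulAction A V] (t : V) where
  /-- the action is by graph automorphisms -/
  act : IsActionByAut G A
  /-- the action is transitive -/
  tr : ∀ v : V, ∃ a : A, a • t = v
  /-- the graph is connected -/
  conn : G.Connected
  /-- the re-based character -/
  ψ : A → Site 2
  /-- additivity -/
  ψ_mul : ∀ a b : A, ψ (a * b) = ψ a + ψ b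
  /-- `ψ` kills the stabiliser of `t` -/
  ψ_stab : ∀ h ∈ MulAction.stabilizer A t, ψ h = 0
  /-- the scale -/
  N : ℕ
  /-- the scale is positive -/
  one_le_N : 1 ≤ N
  /-- sup-norm `≤ N` on the movers of `t` to its neighbours -/
  lipN : ∀ a : A, G.Adj t (a • t) → ∀ i : Fin 2, |ψ a i| ≤ N
  /-- the two step movers -/
  gen : Fin 2 → A
  /-- the step movers move `t` to neighbours -/
  gen_adj : ∀ i : Fin 2, G.Adj t (gen i • t)
  /-- EXACT steps: `ψ (gen i) = N eᵢ` -/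
  ψ_gen : ∀ i : Fin 2, ψ (gen i) = Pi.single i (N : ℤ)
  /-- the kernel displacement bound -/
  m : ℕ
  /-- `ker ψ` is generated by kernel elements moving `t` by at most `m` -/
  ker_gen : ∀ k : A, ψ k = 0 → k ∈ Subgroup.closure {g : A | ψ g = 0 ∧ g • t ∈ graphBall G t m}

namespace ChartDatum

/-- `ψ 1 = 0`. [folklore] -/
theorem ψ_one (D : ChartDatum G A t) : D.ψ 1 = 0 := by
  have e := D.ψ_mul 1 1
  rw [one_mul] at e
  exact left_eq_add.1 e

/-- `ψ a⁻¹ = −ψ a`. [folklore] -/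
theorem ψ_inv (D : ChartDatum G A t) (a : A) : D.ψ a⁻¹ = -D.ψ a := by
  have e := D.ψ_mul a⁻¹ a
  rw [inv_mul_cancel, D.ψ_one] at e
  exact eq_neg_of_add_eq_zero_left e.symm

/-- The section of the orbit map: `sec v • t = v`. [folklore] -/
def sec (D : ChartDatum G A t) (v : V) : A := AutScaled.sec D.tr v

/-- `sec v • t = v`. [folklore] -/
@[simp] theorem sec_smul (D : ChartDatum G A t) (v : V) : D.sec v • t = v := AutScaled.sec_smul D.tr v

/-- `ψ a = ψ (sec (a • t))` (the difference fixes `t`). [folklore] -/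
theorem ψ_eq_sec (D : ChartDatum G A t) (a : A) : D.ψ a = D.ψ (D.sec (a • t)) := by
  have h : (a⁻¹ * D.sec (a • t)) • t = t := by rw [mul_smul, D.sec_smul, inv_smul_smul]
  have h0 := D.ψ_stab _ (MulAction.mem_stabilizer_iff.2 h)
  rw [D.ψ_mul, D.ψ_inv] at h0
  exact neg_add_eq_zero.1 h0

/-- **The chart of `G`**: `φ v := ψ(sec v)`. [folklore] -/
def chart (D : ChartDatum G A t) (v : V) : Site 2 := D.ψ (D.sec v)

/-- **Equivariance**: `φ(a • w) = ψ a + φ w`. [folklore] -/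
theorem chart_smul (D : ChartDatum G A t) (a : A) (w : V) : D.chart (a • w) = D.ψ a + D.chart w := by
  unfold chart
  have h := D.ψ_eq_sec (a * D.sec w)
  rw [mul_smul, D.sec_smul] at h
  rw [← h, D.ψ_mul]

/-- `φ t = 0`. [folklore] -/
theorem chart_base (D : ChartDatum G A t) : D.chart t = 0 := by
  unfold chart
  have h := D.ψ_eq_sec 1
  rw [one_smul, D.ψ_one] at h
  exact h.symm

/-- `φ(a • t) = ψ a`. [folklore] -/
theorem chart_smul_base (D : ChartDatum G A t) (a : A) : D.chart (a • t) = D.ψ a := by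
  rw [D.chart_smul, D.chart_base, add_zero]

/-- `φ (sec v • w) = φ v + φ w`. [folklore] -/
theorem chart_sec (D : ChartDatum G A t) (v : V) : D.ψ (D.sec v) = D.chart v := rfl

/-- **`φ` is `N`-Lipschitz along edges** (every edge is a translate of an edge at `t`). [folklore] -/
theorem chart_lip (D : ChartDatum G A t) {u v : V} (huv : G.Adj u v) (i : Fin 2) : |D.chart u i - D.chart v i| ≤ D.N := by
  obtain ⟨b, rfl⟩ := D.tr u
  have hadj : G.Adj t (b⁻¹ • v) := by
    have h := (D.act b⁻¹ (b • t) v).2 huv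
    rwa [inv_smul_smul] at h
  obtain ⟨a, ha⟩ := D.tr (b⁻¹ • v)
  have hv : v = (b * a) • t := by rw [mul_smul, ha, smul_inv_smul]
  rw [hv, D.chart_smul_base, D.chart_smul_base, D.ψ_mul, Pi.add_apply, sub_add_cancel_left, abs_neg]
  exact D.lipN a (by rw [ha]; exact hadj) i

/-- **Positive exact step at every vertex**: `v ∼ (sec v · gen i) • t` with chart `φ v + N eᵢ`. [folklore] -/
theorem step_pos (D : ChartDatum G A t) (v : V) (i : Fin 2) :
    G.Adj v ((D.sec v * D.gen i) • t) ∧ D.chart ((D.sec v * D.gen i) • t) = D.chart v + Pi.single i (D.N : ℤ) := by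
  constructor
  · have h := (D.act (D.sec v) _ _).2 (D.gen_adj i)
    rwa [D.sec_smul, ← mul_smul] at h
  · rw [D.chart_smul_base, D.ψ_mul, D.ψ_gen, D.chart_sec]

/-- **Negative exact step at every vertex**: `v ∼ (sec v · (gen i)⁻¹) • t` with chart `φ v − N eᵢ`. [folklore] -/
theorem step_neg (D : ChartDatum G A t) (v : V) (i : Fin 2) :
    G.Adj v ((D.sec v * (D.gen i)⁻¹) • t) ∧ D.chart ((D.sec v * (D.gen i)⁻¹) • t) = D.chart v - Pi.single i (D.N : ℤ) := by
  constructor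
  · have h0 := (D.act (D.gen i)⁻¹ _ _).2 (D.gen_adj i)
    rw [inv_smul_smul] at h0
    have h := (D.act (D.sec v) _ _).2 h0.symm
    rwa [D.sec_smul, ← mul_smul] at h
  · rw [D.chart_smul_base, D.ψ_mul, D.ψ_inv, D.ψ_gen, D.chart_sec, sub_eq_add_neg]

/-! ### Walks inside chart boxes -/

/-- `u` and `v` are joined by a walk along which the chart stays in the box of radius `R`. [folklore] -/
def InBox (D : ChartDatum G A t) (R : ℕ) (u v : V) : Prop := ∃ w : G.Walk u v, ∀ z ∈ w.support, D.chart z ∈ box 2 R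

/-- Transitivity of `InBox`. [folklore] -/
theorem inBox_trans (D : ChartDatum G A t) {R : ℕ} {u v w : V} (h₁ : D.InBox R u v) (h₂ : D.InBox R v w) : D.InBox R u w := by
  obtain ⟨w₁, hw₁⟩ := h₁
  obtain ⟨w₂, hw₂⟩ := h₂
  refine ⟨w₁.append w₂, fun z hz => ?_⟩
  rw [Walk.support_append, List.mem_append] at hz
  rcases hz with hz | hz
  · exact hw₁ z hz
  · exact hw₂ z (List.tail_subset _ hz)

/-- Symmetry of `InBox`. [folklore] -/
theorem inBox_symm (D : ChartDatum G A t) {R : ℕ} {u v : V} (h : D.InBox R u v) : D.InBox R v u := by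
  obtain ⟨w, hw⟩ := h
  exact ⟨w.reverse, fun z hz => hw z (by rwa [Walk.support_reverse, List.mem_reverse] at hz)⟩

/-- Monotonicity of `InBox` in the radius. [folklore] -/
theorem inBox_mono (D : ChartDatum G A t) {R R' : ℕ} (hR : R ≤ R') {u v : V} (h : D.InBox R u v) : D.InBox R' u v := by
  obtain ⟨w, hw⟩ := h
  exact ⟨w, fun z hz => box_mono 2 hR (hw z hz)⟩

/-- The support of a translated walk is the translate of the support. [folklore] -/
theorem mem_support_map_smul (D : ChartDatum G A t) (a : A) {u v : V} (w : G.Walk u v) {z : V}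
    (hz : z ∈ (w.map (smulIso D.act a).toHom).support) : ∃ z₀ ∈ w.support, a • z₀ = z := by
  induction w with
  | nil =>
    rw [Walk.map_nil, Walk.support_nil, List.mem_singleton] at hz
    exact ⟨_, Walk.start_mem_support _, hz.symm⟩
  | cons h w ih =>
    rw [Walk.map_cons, Walk.support_cons, List.mem_cons] at hz
    rcases hz with hz | hz
    · exact ⟨_, Walk.start_mem_support _, hz.symm⟩
    · obtain ⟨z₀, hz₀, rfl⟩ := ih hz
      exact ⟨z₀, by rw [Walk.support_cons]; exact List.mem_cons_of_mem _ hz₀, rfl⟩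

/-- **Translating a boxed walk**: by `a` with `‖ψ a‖_∞ ≤ S`, the box radius grows by `S`. [folklore] -/
theorem inBox_smul (D : ChartDatum G A t) (a : A) {S : ℕ} (ha : ∀ i : Fin 2, |D.ψ a i| ≤ S) {R : ℕ} {u v : V} (h : D.InBox R u v) :
    D.InBox (S + R) (a • u) (a • v) := by
  obtain ⟨w, hw⟩ := h
  refine ⟨w.map (smulIso D.act a).toHom, fun z hz => ?_⟩
  obtain ⟨z₀, hz₀, rfl⟩ := D.mem_support_map_smul a w hz
  have hb := hw z₀ hz₀
  rw [mem_box] at hb ⊢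
  intro i
  rw [D.chart_smul, Pi.add_apply]
  have h1 := hb i
  have h2 := ha i
  rw [abs_le] at h2
  push_cast
  constructor <;> omega

/-- **Along a walk of length `ℓ` the chart moves by at most `N ℓ`** per coordinate. [folklore] -/
theorem chart_walk_bound (D : ChartDatum G A t) :
    ∀ {u v : V} (w : G.Walk u v), ∀ z ∈ w.support, ∀ i : Fin 2, |D.chart z i - D.chart u i| ≤ D.N * w.length
  | _, _, Walk.nil => by
    intro z hz i
    rw [Walk.support_nil, List.mem_singleton] at hz
    subst hz
    simp
  | u, _, Walk.cons (v := u') h w => by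
    intro z hz i
    rw [Walk.support_cons, List.mem_cons] at hz
    rw [Walk.length_cons]
    rcases hz with rfl | hz
    · simp
    · have ih := chart_walk_bound D w z hz i
      have hl := D.chart_lip h i
      rw [abs_le] at ih hl ⊢
      push_cast at ih ⊢
      constructor <;> nlinarith

/-- A vertex of `B(t, n)` is joined to `t` inside the box of radius `N n`. [folklore] -/
theorem inBox_of_mem_graphBall (D : ChartDatum G A t) {v : V} {n : ℕ} (hv : v ∈ graphBall G t n) : D.InBox (D.N * n) t v := by
  obtain ⟨w, hw⟩ := hv
  refine ⟨w, fun z hz => ?_⟩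
  rw [mem_box]
  intro i
  have h := D.chart_walk_bound w z hz i
  rw [D.chart_base, Pi.zero_apply, sub_zero, abs_le] at h
  have hmono : (D.N : ℤ) * w.length ≤ (D.N : ℤ) * n := by exact_mod_cast Nat.mul_le_mul_left D.N hw
  push_cast
  constructor <;> linarith [h.1, h.2]

/-- **Kernel walks**: every `k ∈ ker ψ` moves `t` along a walk inside the box of radius `N m` (closure induction over the bounded kernel generators;
kernel translates do not move the chart). [cite: MilnorSolvableGrowth1968, Lemma 1] -/
theorem ker_inBox (D : ChartDatum G A t) {k : A} (hk : D.ψ k = 0) : D.InBox (D.N * D.m) t (k • t) := by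
  have hmem := D.ker_gen k hk
  suffices H : D.ψ k = 0 ∧ D.InBox (D.N * D.m) t (k • t) from H.2
  clear hk
  induction hmem using Subgroup.closure_induction with
  | mem g hg => exact ⟨hg.1, D.inBox_of_mem_graphBall hg.2⟩
  | one =>
    refine ⟨D.ψ_one, ?_⟩
    rw [one_smul]
    refine ⟨Walk.nil, fun z hz => ?_⟩
    rw [Walk.support_nil, List.mem_singleton] at hz
    subst hz
    rw [D.chart_base]
    exact zero_mem_box 2 _
  | mul x y _ _ hx hy =>
    obtain ⟨hx0, hbx⟩ := hx
    obtain ⟨hy0, hby⟩ := hy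
    refine ⟨by rw [D.ψ_mul, hx0, hy0, add_zero], ?_⟩
    have h2 := D.inBox_smul x (S := 0) (fun i => by rw [hx0, Pi.zero_apply, abs_zero]; rfl) hby
    rw [Nat.zero_add] at h2
    rw [mul_smul]
    exact D.inBox_trans hbx h2
  | inv x _ hx =>
    obtain ⟨hx0, hbx⟩ := hx
    have hx0' : D.ψ x⁻¹ = 0 := by rw [D.ψ_inv, hx0, neg_zero]
    refine ⟨hx0', ?_⟩
    have h2 := D.inBox_smul x⁻¹ (S := 0) (fun i => by rw [hx0', Pi.zero_apply, abs_zero]; rfl) hbx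
    rw [Nat.zero_add, inv_smul_smul] at h2
    exact D.inBox_symm h2

/-- A boxed walk of radius `R ≤ ℓ` is a walk of the cylinder of width `ℓ`. [folklore] -/
theorem reach_of_inBox (D : ChartDatum G A t) {ℓ R : ℕ} (hR : R ≤ ℓ) {u v : V} (h : D.InBox R u v)
    (hu : u ∈ {w | D.chart w - D.chart t ∈ box 2 ℓ}) (hv : v ∈ {w | D.chart w - D.chart t ∈ box 2 ℓ}) :
    (G.induce {w | D.chart w - D.chart t ∈ box 2 ℓ}).Reachable ⟨u, hu⟩ ⟨v, hv⟩ := by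
  obtain ⟨w, hw⟩ := h
  have hw' : ∀ z ∈ w.support, z ∈ {w | D.chart w - D.chart t ∈ box 2 ℓ} := fun z hz => by
    show D.chart z - D.chart t ∈ box 2 ℓ
    rw [D.chart_base, sub_zero]
    exact box_mono 2 hR (hw z hz)
  exact ⟨w.induce _ hw'⟩

end ChartDatum

end AutChart

end Summit.CriticalPhenomena.PercolationContinuityZ3.Theorems.Transplant

end
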